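import Summits.QuantumFields.QCD.Theses.SpectralDefectExtinction
import Literature.MathematicalPhysics.QuantumFieldTheory.QCDPhaseQuenched
import Literature.MathematicalPhysics.QuantumFieldTheory.SpectralDefectDensity
import Literature.Barriers.QuantumFields.WilsonDeterminantMassSplitting

/-!
# Stub `diracLocality` of line `Sketch` (skeleton "ResolventCell") for crux
`SpectralDefectExtinction.WegnerEstimate` (item stmt-QuantumFields-8966)

Two locality facts about the Hermitian Wilson–Dirac matrix `H(W) = Γ₅ D_W(W, m₀, 1)` on the torus
`(ZMod L)^4` (index `QuarkIdx L = site × colour × spin`), relative to the cubes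
`C_R = {x + proj_L y : y ∈ box 4 R} ⊆ C_{R+1}` around a site `x`:

* (nearest neighbour) an entry `H p q` with `p.1 ∈ C_R` and `q.1 ∉ C_{R+1}` vanishes, and so does
  `H q p`: `D_W` is `Matrix.of` of a diagonal term and hops along `q.1 = p.1 + μ̂` /
  `p.1 = q.1 + μ̂`, and a neighbour of a site of `C_R` lies in `C_{R+1}`;
* (no dependence on the cell) an entry `H p q` or `H q p` with `q.1 ∉ C_{R+1}` of the glued
  configuration `e ↦ if e.1 ∈ C_R then V e else U e` does not depend on `V`: the links entering it
  are based at `p.1` (only when `q.1 = p.1 + μ̂`, forcing `p.1 ∉ C_R`) or at `q.1 ∉ C_R`, where the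
  glue reads `U`.

`Γ₅` only multiplies rows by signs (`spinorLift_gammaFive_eq_diagonal`, `Matrix.diagonal_mul`), so
everything reduces to the entries of `wilsonDirac` (`Matrix.of_apply`) and torus bookkeeping
(`Torus.proj` is additive and fixes the unit vectors `Pi.single μ 1`).
-/

noncomputable section

namespace Summit.QuantumFields.QCD.Cruxes.WegnerEstimate.ResolventCell

open MeasureTheory
open scoped Matrix BigOperators
open Literature.MathematicalPhysics.QuantumLattice Literature.MathematicalPhysics.QuantumFieldTheory
  Literature.Probability.LatticeModels
open Literature.Barriers.QuantumFields (isHermitian_gammaFive_mul_wilsonDirac)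
open Matrix
open scoped ComplexOrder

/-! ### Entries of the Wilson–Dirac matrix -/

/-- Off-site entries of `D_W` vanish beyond nearest neighbours: if `p ≠ q` and `q.1` is neither
`p.1 + μ̂` nor `p.1 - μ̂` for any direction `μ`, then `D_W p q = 0`. -/
theorem diracLocality_wilsonDirac_apply_eq_zero {G : Type*} [Group G] {N L : ℕ}
    (ρ : G →* Matrix (Fin N) (Fin N) ℂ) (W : GaugeConfig 4 L G) (m r : ℝ)
    {p q : TorusSite 4 L × Fin N × Fin 4} (hpq : p ≠ q)
    (h1 : ∀ μ : Fin 4, q.1 ≠ Site.shift p.1 μ) (h2 : ∀ μ : Fin 4, p.1 ≠ Site.shift q.1 μ) :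
    wilsonDirac ρ W m r p q = 0 := by
  simp only [wilsonDirac, Matrix.of_apply, if_neg hpq, if_neg (h1 _), if_neg (h2 _), add_zero,
    Finset.sum_const_zero, mul_zero, sub_zero]

/-- The entry `D_W p q` only sees the links `W (p.1, μ)` with `q.1 = p.1 + μ̂` and `W (q.1, μ)` with
`p.1 = q.1 + μ̂`: two configurations agreeing on those links have the same entry. -/
theorem diracLocality_wilsonDirac_apply_congr {G : Type*} [Group G] {N L : ℕ}
    (ρ : G →* Matrix (Fin N) (Fin N) ℂ) (W W' : GaugeConfig 4 L G) (m r : ℝ)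
    (p q : TorusSite 4 L × Fin N × Fin 4)
    (hp : ∀ μ : Fin 4, q.1 = Site.shift p.1 μ → W (p.1, μ) = W' (p.1, μ))
    (hq : ∀ μ : Fin 4, p.1 = Site.shift q.1 μ → W (q.1, μ) = W' (q.1, μ)) :
    wilsonDirac ρ W m r p q = wilsonDirac ρ W' m r p q := by
  simp only [wilsonDirac, Matrix.of_apply]
  congr 2
  refine Finset.sum_congr rfl fun μ _ => ?_
  congr 1
  · split_ifs with h
    · rw [hp μ h]
    · rfl
  · split_ifs with h
    · rw [hq μ h]
    · rfl

/-! ### Torus bookkeeping: neighbours of the radius-`R` cube lie in the radius-`(R+1)` cube -/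

/-- `Torus.proj` is additive. -/
theorem diracLocality_proj_add (L : ℕ) (y z : Fin 4 → ℤ) :
    Torus.proj L (y + z) = Torus.proj L y + Torus.proj L z := by
  funext i
  simp [Torus.proj_apply, Int.cast_add]

/-- `Torus.proj` commutes with subtraction. -/
theorem diracLocality_proj_sub (L : ℕ) (y z : Fin 4 → ℤ) :
    Torus.proj L (y - z) = Torus.proj L y - Torus.proj L z := by
  funext i
  simp [Torus.proj_apply, Int.cast_sub]

/-- `Torus.proj` fixes the unit vectors. -/
theorem diracLocality_proj_single (L : ℕ) (μ : Fin 4) :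
    Torus.proj L (Pi.single μ 1 : Fin 4 → ℤ) = (Pi.single μ 1 : TorusSite 4 L) := by
  funext i
  by_cases h : i = μ
  · subst h
    simp
  · simp [h]

/-- The unit vectors lie in the unit box. -/
theorem diracLocality_single_mem_box (μ : Fin 4) : (Pi.single μ 1 : Fin 4 → ℤ) ∈ box 4 1 := by
  rw [mem_box]
  intro i
  by_cases h : i = μ
  · subst h
    simp
  · simp [h]

/-- `box R + box 1 ⊆ box (R+1)`. -/
theorem diracLocality_add_mem_box {R : ℕ} {y z : Fin 4 → ℤ} (hy : y ∈ box 4 R) (hz : z ∈ box 4 1) :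
    y + z ∈ box 4 (R + 1) := by
  rw [mem_box] at hy hz ⊢
  intro i
  obtain ⟨h₁, h₂⟩ := hy i
  obtain ⟨h₃, h₄⟩ := hz i
  simp only [Pi.add_apply]
  push_cast
  constructor <;> omega

/-- `box R - box 1 ⊆ box (R+1)`. -/
theorem diracLocality_sub_mem_box {R : ℕ} {y z : Fin 4 → ℤ} (hy : y ∈ box 4 R) (hz : z ∈ box 4 1) :
    y - z ∈ box 4 (R + 1) := by
  rw [mem_box] at hy hz ⊢
  intro i
  obtain ⟨h₁, h₂⟩ := hy i
  obtain ⟨h₃, h₄⟩ := hz i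
  simp only [Pi.sub_apply]
  push_cast
  constructor <;> omega

/-- The radius-`R` cube around `x` is contained in the radius-`(R+1)` cube. -/
theorem diracLocality_mem_mono {R L : ℕ} {x s : TorusSite 4 L}
    (hs : ∃ y ∈ box 4 R, s = x + Torus.proj L y) :
    ∃ y ∈ box 4 (R + 1), s = x + Torus.proj L y := by
  obtain ⟨y, hy, h⟩ := hs
  exact ⟨y, box_mono 4 (Nat.le_succ R) hy, h⟩

/-- A forward neighbour `s + μ̂` of a site `s` of the radius-`R` cube around `x` lies in the
radius-`(R+1)` cube. -/
theorem diracLocality_shift_mem {R L : ℕ} {x s : TorusSite 4 L}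
    (hs : ∃ y ∈ box 4 R, s = x + Torus.proj L y) (μ : Fin 4) :
    ∃ y ∈ box 4 (R + 1), Site.shift s μ = x + Torus.proj L y := by
  obtain ⟨y, hy, rfl⟩ := hs
  refine ⟨y + Pi.single μ 1, diracLocality_add_mem_box hy (diracLocality_single_mem_box μ), ?_⟩
  rw [diracLocality_proj_add, diracLocality_proj_single,
    Literature.MathematicalPhysics.QuantumFieldTheory.Site.shift, add_assoc]

/-- A backward neighbour `t` (`s = t + μ̂`) of a site `s` of the radius-`R` cube around `x` lies in
the radius-`(R+1)` cube. -/
theorem diracLocality_unshift_mem {R L : ℕ} {x s : TorusSite 4 L}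
    (hs : ∃ y ∈ box 4 R, s = x + Torus.proj L y) (μ : Fin 4) {t : TorusSite 4 L}
    (ht : s = Site.shift t μ) : ∃ y ∈ box 4 (R + 1), t = x + Torus.proj L y := by
  obtain ⟨y, hy, rfl⟩ := hs
  refine ⟨y - Pi.single μ 1, diracLocality_sub_mem_box hy (diracLocality_single_mem_box μ), ?_⟩
  rw [diracLocality_proj_sub, diracLocality_proj_single, ← add_sub_assoc, ht,
    Literature.MathematicalPhysics.QuantumFieldTheory.Site.shift, add_sub_cancel_right]

/-! ### The same for `H = Γ₅ D_W` (rows multiplied by signs) -/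

/-- `H p q = 0` for `p ≠ q` non-adjacent (`H = Γ₅ D_W` is `D_W` with rows multiplied by signs). -/
theorem diracLocality_gammaFive_mul_apply_eq_zero {L : ℕ} [NeZero L] (W : GaugeConfig 4 L SU3) (m₀ : ℝ)
    {p q : QuarkIdx L} (hpq : p ≠ q)
    (h1 : ∀ μ : Fin 4, q.1 ≠ Site.shift p.1 μ) (h2 : ∀ μ : Fin 4, p.1 ≠ Site.shift q.1 μ) :
    (spinorLift gammaFive * wilsonDirac (fundamentalRep (Fin 3)) W m₀ 1 :
      Matrix (QuarkIdx L) (QuarkIdx L) ℂ) p q = 0 := by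
  rw [spinorLift_gammaFive_eq_diagonal, diagonal_mul,
    diracLocality_wilsonDirac_apply_eq_zero _ W m₀ 1 hpq h1 h2, mul_zero]

/-- `H p q` agrees for two configurations agreeing on the links entering `D_W p q`. -/
theorem diracLocality_gammaFive_mul_apply_congr {L : ℕ} [NeZero L] (W W' : GaugeConfig 4 L SU3)
    (m₀ : ℝ)
    (p q : QuarkIdx L)
    (hp : ∀ μ : Fin 4, q.1 = Site.shift p.1 μ → W (p.1, μ) = W' (p.1, μ))
    (hq : ∀ μ : Fin 4, p.1 = Site.shift q.1 μ → W (q.1, μ) = W' (q.1, μ)) :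
    (spinorLift gammaFive * wilsonDirac (fundamentalRep (Fin 3)) W m₀ 1 :
      Matrix (QuarkIdx L) (QuarkIdx L) ℂ) p q =
    (spinorLift gammaFive * wilsonDirac (fundamentalRep (Fin 3)) W' m₀ 1 :
      Matrix (QuarkIdx L) (QuarkIdx L) ℂ) p q := by
  rw [spinorLift_gammaFive_eq_diagonal, diagonal_mul, diagonal_mul,
    diracLocality_wilsonDirac_apply_congr _ W W' m₀ 1 p q hp hq]

/-! ### The stub -/

/-- **Stub `diracLocality` (Wilson–Dirac is nearest-neighbour).**  For `H(W) = Γ₅ D_W(W, m₀, 1)`: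
(i) entries `H p q`, `H q p` with `p.1` in the radius-`R` cube around `x` and `q.1` outside the
radius-`(R+1)` cube vanish; (ii) entries `H p q`, `H q p` with `q.1` outside the radius-`(R+1)`
cube of the glued configuration `e ↦ if e.1 ∈ C_R then V e else U e` do not depend on the cell
links `V`. -/
theorem stub_diracLocality (R : ℕ) (L : ℕ) [NeZero L] (x : TorusSite 4 L) (U : GaugeConfig 4 L SU3) (m₀ : ℝ) :
    (∀ (W : GaugeConfig 4 L SU3) (p q : QuarkIdx L), (∃ y ∈ box 4 R, p.1 = x + Torus.proj L y) →
        (¬ ∃ y ∈ box 4 (R + 1), q.1 = x + Torus.proj L y) →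
        (spinorLift gammaFive * wilsonDirac (fundamentalRep (Fin 3)) W m₀ 1 :
          Matrix (QuarkIdx L) (QuarkIdx L) ℂ) p q = 0 ∧
        (spinorLift gammaFive * wilsonDirac (fundamentalRep (Fin 3)) W m₀ 1 :
          Matrix (QuarkIdx L) (QuarkIdx L) ℂ) q p = 0) ∧
    (∀ (V V' : GaugeConfig 4 L SU3) (p q : QuarkIdx L), (¬ ∃ y ∈ box 4 (R + 1), q.1 = x + Torus.proj L y) →
        (spinorLift gammaFive * wilsonDirac (fundamentalRep (Fin 3))
            (fun e => if (∃ y ∈ box 4 R, e.1 = x + Torus.proj L y) then V e else U e) m₀ 1 :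
          Matrix (QuarkIdx L) (QuarkIdx L) ℂ) p q =
          (spinorLift gammaFive * wilsonDirac (fundamentalRep (Fin 3))
            (fun e => if (∃ y ∈ box 4 R, e.1 = x + Torus.proj L y) then V' e else U e) m₀ 1 :
          Matrix (QuarkIdx L) (QuarkIdx L) ℂ) p q ∧
        (spinorLift gammaFive * wilsonDirac (fundamentalRep (Fin 3))
            (fun e => if (∃ y ∈ box 4 R, e.1 = x + Torus.proj L y) then V e else U e) m₀ 1 :
          Matrix (QuarkIdx L) (QuarkIdx L) ℂ) q p =
          (spinorLift gammaFive * wilsonDirac (fundamentalRep (Fin 3))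
            (fun e => if (∃ y ∈ box 4 R, e.1 = x + Torus.proj L y) then V' e else U e) m₀ 1 :
          Matrix (QuarkIdx L) (QuarkIdx L) ℂ) q p) := by
  refine ⟨fun W p q hp hq => ?_, fun V V' p q hq => ?_⟩
  · -- (i): `p.1 ∈ C_R`, `q.1 ∉ C_{R+1}`, so `p`, `q` are neither equal nor adjacent
    have hpq : p ≠ q := by
      rintro rfl
      exact hq (diracLocality_mem_mono hp)
    have h1 : ∀ μ : Fin 4, q.1 ≠ Site.shift p.1 μ := fun μ h =>
      hq (h ▸ diracLocality_shift_mem hp μ)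
    have h2 : ∀ μ : Fin 4, p.1 ≠ Site.shift q.1 μ := fun μ h =>
      hq (diracLocality_unshift_mem hp μ h)
    exact ⟨diracLocality_gammaFive_mul_apply_eq_zero W m₀ hpq h1 h2,
      diracLocality_gammaFive_mul_apply_eq_zero W m₀ (Ne.symm hpq) h2 h1⟩
  · -- (ii): the links entering `H p q`, `H q p` are based outside `C_R`, where the glue reads `U`
    have hq0 : ¬ ∃ y ∈ box 4 R, q.1 = x + Torus.proj L y := fun h => hq (diracLocality_mem_mono h)
    have hp0 : ∀ μ : Fin 4, q.1 = Site.shift p.1 μ → ¬ ∃ y ∈ box 4 R, p.1 = x + Torus.proj L y :=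
      fun μ h hp => hq (h ▸ diracLocality_shift_mem hp μ)
    refine ⟨?_, ?_⟩
    · refine diracLocality_gammaFive_mul_apply_congr _ _ m₀ p q (fun μ h => ?_) (fun μ _ => ?_)
      · simp only [if_neg (hp0 μ h)]
      · simp only [if_neg hq0]
    · refine diracLocality_gammaFive_mul_apply_congr _ _ m₀ q p (fun μ _ => ?_) (fun μ h => ?_)
      · simp only [if_neg hq0]
      · simp only [if_neg (hp0 μ h)]

end Summit.QuantumFields.QCD.Cruxes.WegnerEstimate.ResolventCell
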